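import Literature.NumberTheory.Automorphic.LevelActionReductionKernel
import HarnessLib

/-!
# The lattice `⨂_τ Sym^{k−2}` modulo `ϖⁿ`: `ker (ϖ^{n−1} ·) = ϖ V`, `V[ϖ] = ϖ^{n−1} V`, reduction to `ϖ¹`

Topic `NumberTheory/Automorphic`; namespaces `Literature.NumberTheory.Automorphic` (generic algebra)
and `…ParallelWeight` (the lattice); theorems only (no named fact, no `sorry`).  Elementary
coefficient algebra feeding the uniform `p`-torsion bound of Hida's control theorem in degree `1`
(`LevelActionTorsionBound`, [Hida1994AIF, §3]): for a domain `𝒪`, `ϖ ≠ 0`, `n ≥ 1` and the free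
`𝒪/ϖⁿ`-module `V = ⨂_τ Sym^{k−2}((𝒪/ϖⁿ)²)`,

* `smul_eq_zero_iff_exists_of_free` — transfer of "`a s = 0 ⇒ s ∈ bS`" from a ring to its free
  modules;
* `Quotient.exists_of_pow_pred_mul_eq_zero`, `Quotient.exists_of_mul_eq_zero` — in `𝒪/ϖⁿ`:
  `ϖ^{n−1} s = 0 ⇒ s ∈ (ϖ)`, `ϖ s = 0 ⇒ s ∈ (ϖ^{n−1})`;
* `lattice_pow_pred_smul_eq_zero_iff`, `lattice_smul_eq_zero_iff` — the two identities of the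
  title on `V`;
* `latticeChange_factor_latticeReduce`, `latticeChange_factor_surjective`,
  `latticeChange_factor_eq_zero_iff`, `latticeChange_factor_symLatticeAction` — the change of rings
  `𝒪/I → 𝒪/J` (`I ≤ J`) on the lattice is surjective, equivariant, and for `J = (ϖ)` has kernel `ϖ V`.

## References

* H. Hida, Ann. Inst. Fourier 44 (1994), §1, §3 (held). [Hida1994AIF]
* C. Khare, J. A. Thorne, Amer. J. Math. 139 (2017), §6.4 (arXiv:1409.7007, held). [KhareThorne2017]
-/

noncomputable section

open IsDedekindDomain NumberField

namespace Literature.NumberTheory.Automorphic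

/-! ### Generic algebra -/

/-- **Transfer to free modules**: if `a s = 0 ⇒ s ∈ bS` in `S` and `ab = 0`, then on a free `S`-module
`a x = 0 ↔ x ∈ bM`. [folklore] -/
theorem smul_eq_zero_iff_exists_of_free {S : Type*} [CommRing S] {M : Type*} [AddCommGroup M] [Module S M]
    [Module.Free S M] {a b : S} (hab : a * b = 0) (hs : ∀ s : S, a * s = 0 → ∃ t, b * t = s) (x : M) :
    a • x = 0 ↔ ∃ y, b • y = x := by
  classical
  constructor
  · intro hx
    let B := Module.Free.chooseBasis S M
    have hcoord : ∀ i, a * B.repr x i = 0 := fun i => by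
      have h := congrArg (fun z => B.repr z i) hx
      simpa only [map_smul, Finsupp.smul_apply, smul_eq_mul, map_zero, Finsupp.zero_apply] using h
    choose t ht using fun i => hs _ (hcoord i)
    let c : Module.Free.ChooseBasisIndex S M →₀ S :=
      Finsupp.onFinset (B.repr x).support (fun i => if B.repr x i = 0 then 0 else t i) (fun i hi => by
        rw [Finsupp.mem_support_iff]
        intro h0
        exact hi (if_pos h0))
    refine ⟨B.repr.symm c, B.repr.injective ?_⟩
    rw [map_smul, LinearEquiv.apply_symm_apply]
    ext i
    rw [Finsupp.smul_apply, Finsupp.onFinset_apply, smul_eq_mul]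
    split_ifs with h0
    · rw [mul_zero, h0]
    · exact ht i
  · rintro ⟨y, rfl⟩
    rw [← mul_smul, hab, zero_smul]

section Ring

variable {O : Type*} [CommRing O] [IsDomain O] {ϖ : O}

/-- In `𝒪/ϖⁿ` (`𝒪` a domain, `ϖ ≠ 0`, `n ≥ 1`): `ϖ^{n−1} s = 0 ⇒ s ∈ (ϖ)`. [folklore] -/
theorem Quotient.exists_of_pow_pred_mul_eq_zero (hϖ : ϖ ≠ 0) {n : ℕ} (hn : 1 ≤ n)
    (s : O ⧸ Ideal.span {ϖ ^ n}) (h : Ideal.Quotient.mk _ ϖ ^ (n - 1) * s = 0) :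
    ∃ t, Ideal.Quotient.mk _ ϖ * t = s := by
  obtain ⟨o, rfl⟩ := Ideal.Quotient.mk_surjective s
  rw [← map_pow, ← map_mul, Ideal.Quotient.eq_zero_iff_mem, Ideal.mem_span_singleton'] at h
  obtain ⟨c, hc⟩ := h
  have hn' : n = (n - 1) + 1 := (Nat.sub_add_cancel hn).symm
  have ho : o = ϖ * c := by
    refine mul_left_cancel₀ (pow_ne_zero (n - 1) hϖ) ?_
    rw [← hc, hn', pow_succ]
    simp only [Nat.add_sub_cancel]
    ring
  exact ⟨Ideal.Quotient.mk _ c, by rw [← map_mul, ho]⟩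

/-- In `𝒪/ϖⁿ` (`𝒪` a domain, `ϖ ≠ 0`, `n ≥ 1`): `ϖ s = 0 ⇒ s ∈ (ϖ^{n−1})`. [folklore] -/
theorem Quotient.exists_of_mul_eq_zero (hϖ : ϖ ≠ 0) {n : ℕ} (hn : 1 ≤ n)
    (s : O ⧸ Ideal.span {ϖ ^ n}) (h : Ideal.Quotient.mk _ ϖ * s = 0) :
    ∃ t, Ideal.Quotient.mk _ ϖ ^ (n - 1) * t = s := by
  obtain ⟨o, rfl⟩ := Ideal.Quotient.mk_surjective s
  rw [← map_mul, Ideal.Quotient.eq_zero_iff_mem, Ideal.mem_span_singleton'] at h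
  obtain ⟨c, hc⟩ := h
  have hn' : n = (n - 1) + 1 := (Nat.sub_add_cancel hn).symm
  have ho : o = ϖ ^ (n - 1) * c := by
    refine mul_left_cancel₀ hϖ ?_
    rw [← hc, hn', pow_succ]
    simp only [Nat.add_sub_cancel]
    ring
  exact ⟨Ideal.Quotient.mk _ c, by rw [← map_pow, ← map_mul, ho]⟩

omit [IsDomain O] in
/-- `ϖ^{n-1} · ϖ = 0` in `𝒪/ϖⁿ` (`n ≥ 1`). [folklore] -/
theorem Quotient.pow_pred_mul_self_eq_zero {n : ℕ} (hn : 1 ≤ n) :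
    (Ideal.Quotient.mk (Ideal.span {ϖ ^ n}) ϖ) ^ (n - 1) * Ideal.Quotient.mk _ ϖ = 0 := by
  rw [← pow_succ, Nat.sub_add_cancel hn, ← map_pow, Ideal.Quotient.eq_zero_iff_mem]
  exact Ideal.mem_span_singleton_self _

omit [IsDomain O] in
/-- `ϖⁿ = 0` in `𝒪/ϖⁿ`, written `ϖ^{(n−1)+1}` (`n ≥ 1`). [folklore] -/
theorem Quotient.pow_pred_succ_eq_zero {n : ℕ} (hn : 1 ≤ n) :
    (Ideal.Quotient.mk (Ideal.span {ϖ ^ n}) ϖ) ^ (n - 1 + 1) = 0 := by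
  rw [Nat.sub_add_cancel hn, ← map_pow, Ideal.Quotient.eq_zero_iff_mem]
  exact Ideal.mem_span_singleton_self _

end Ring

/-! ### The lattice -/

namespace ParallelWeight

open BigHeckeGLn IntegralWeightGL2

variable (O : Type) [CommRing O] (E : Type) [Field E] [CharZero E] (F : Type) [Field F]
  [NumberField F] (k : ℕ) (v : (F →+* E) → HeightOneSpectrum (𝓞 F))
  (φO : ∀ τ : F →+* E, (v τ).adicCompletionIntegers F →+* O)

section Domain

variable [IsDomain O] {ϖ : O}

/-- **`ker (ϖ^{n−1} ·) = ϖ V`** on `V = ⨂_τ Sym^{k−2}((𝒪/ϖⁿ)²)`. [folklore] -/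
theorem lattice_pow_pred_smul_eq_zero_iff (hϖ : ϖ ≠ 0) {n : ℕ} (hn : 1 ≤ n)
    (x : SymCoeffLattice (O ⧸ Ideal.span {ϖ ^ n}) E F k) :
    (Ideal.Quotient.mk (Ideal.span {ϖ ^ n}) ϖ) ^ (n - 1) • x = 0 ↔
      ∃ y, (Ideal.Quotient.mk (Ideal.span {ϖ ^ n}) ϖ) • y = x := by
  haveI : Module.Free (O ⧸ Ideal.span {ϖ ^ n}) (SymCoeffLattice (O ⧸ Ideal.span {ϖ ^ n}) E F k) :=
    Module.Free.of_basis (latticeBasis _ E F k)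
  exact smul_eq_zero_iff_exists_of_free (Quotient.pow_pred_mul_self_eq_zero hn)
    (Quotient.exists_of_pow_pred_mul_eq_zero hϖ hn) x

/-- **`V[ϖ] = ϖ^{n−1} V`** on `V = ⨂_τ Sym^{k−2}((𝒪/ϖⁿ)²)`. [folklore] -/
theorem lattice_smul_eq_zero_iff (hϖ : ϖ ≠ 0) {n : ℕ} (hn : 1 ≤ n)
    (x : SymCoeffLattice (O ⧸ Ideal.span {ϖ ^ n}) E F k) :
    (Ideal.Quotient.mk (Ideal.span {ϖ ^ n}) ϖ) • x = 0 ↔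
      ∃ y, (Ideal.Quotient.mk (Ideal.span {ϖ ^ n}) ϖ) ^ (n - 1) • y = x := by
  haveI : Module.Free (O ⧸ Ideal.span {ϖ ^ n}) (SymCoeffLattice (O ⧸ Ideal.span {ϖ ^ n}) E F k) :=
    Module.Free.of_basis (latticeBasis _ E F k)
  have hab : Ideal.Quotient.mk (Ideal.span {ϖ ^ n}) ϖ * Ideal.Quotient.mk _ ϖ ^ (n - 1) = 0 := by
    rw [mul_comm]; exact Quotient.pow_pred_mul_self_eq_zero hn
  exact smul_eq_zero_iff_exists_of_free hab (Quotient.exists_of_mul_eq_zero hϖ hn) x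

end Domain

/-! ### Change of rings `𝒪/I → 𝒪/J` on the lattice -/

section Factor

variable {I J : Ideal O} (h : I ≤ J)

omit [NumberField F] in
/-- `symPowMap` along `𝒪/I → 𝒪/J` after reduction mod `I` is reduction mod `J`. [folklore] -/
theorem symPowMap_factor_symPowMap (m : ℕ) (z : SymPow O m) :
    symPowMap (Ideal.Quotient.factor h) m (symPowMap (Ideal.Quotient.mk I) m z) =
      symPowMap (Ideal.Quotient.mk J) m z := by
  refine Subtype.ext ?_
  rw [coe_symPowMap_apply, coe_symPowMap_apply, coe_symPowMap_apply, MvPolynomial.map_map,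
    Ideal.Quotient.factor_comp_mk]

/-- **`(𝒪/I → 𝒪/J)_* ∘ (reduction mod I) = reduction mod J`** on the lattice. [folklore] -/
theorem latticeChange_factor_latticeReduce (y : SymCoeffLattice O E F k) :
    latticeChange (O ⧸ I) (O ⧸ J) E F k (Ideal.Quotient.factor h) (latticeReduce O E F k I y) =
      latticeReduce O E F k J y := by
  induction y using SymCoeffLattice.induction_on with
  | smul_tprod r x =>
    rw [map_smulₛₗ, map_smulₛₗ, map_smulₛₗ, latticeReduce_ltprod, latticeReduce_ltprod, latticeChange_ltprod,
      Ideal.Quotient.factor_mk]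
    congr 1
    exact congrArg ltprod (funext fun τ => symPowMap_factor_symPowMap O h (k - 2) (x τ))
  | add y z hy hz => rw [map_add, map_add, map_add, hy, hz]

/-- **The change of rings `𝒪/I → 𝒪/J` on the lattice is surjective.** [folklore] -/
theorem latticeChange_factor_surjective :
    Function.Surjective (latticeChange (O ⧸ I) (O ⧸ J) E F k (Ideal.Quotient.factor h)) := fun z => by
  obtain ⟨y, rfl⟩ := latticeReduce_surjective O E F k J z
  exact ⟨latticeReduce O E F k I y, latticeChange_factor_latticeReduce O E F k h y⟩

/-- **Its kernel for `J = (ϖ)` is `ϖ V`.** [folklore] -/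
theorem latticeChange_factor_eq_zero_iff {ϖ : O} (h : I ≤ Ideal.span {ϖ}) (x : SymCoeffLattice (O ⧸ I) E F k) :
    latticeChange (O ⧸ I) (O ⧸ Ideal.span {ϖ}) E F k (Ideal.Quotient.factor h) x = 0 ↔
      ∃ y, (Ideal.Quotient.mk I ϖ) • y = x := by
  constructor
  · intro hx
    obtain ⟨x', rfl⟩ := latticeReduce_surjective O E F k I x
    rw [latticeChange_factor_latticeReduce, latticeReduce_eq_zero_iff] at hx
    obtain ⟨y', rfl⟩ := hx
    exact ⟨latticeReduce O E F k I y', by rw [map_smulₛₗ]⟩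
  · rintro ⟨y, rfl⟩
    rw [map_smulₛₗ, Ideal.Quotient.factor_mk, Ideal.Quotient.eq_zero_iff_mem.2 (Ideal.mem_span_singleton_self ϖ),
      zero_smul]

omit [CharZero E] in
/-- The place maps modulo `J` factor through those modulo `I`. [folklore] -/
theorem factor_comp_comp_eq :
    (fun τ => (Ideal.Quotient.factor h).comp ((Ideal.Quotient.mk I).comp (φO τ))) =
      fun τ => (Ideal.Quotient.mk J).comp (φO τ) :=
  funext fun τ => by rw [← RingHom.comp_assoc, Ideal.Quotient.factor_comp_mk]

omit [CharZero E] in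
/-- **The change of rings `𝒪/I → 𝒪/J` is equivariant** for the integral actions modulo `I` and `J`.
[cite: KhareThorne2017, §6.4] -/
theorem latticeChange_factor_symLatticeAction (g : integralMonoid F v) (x : SymCoeffLattice (O ⧸ I) E F k) :
    latticeChange (O ⧸ I) (O ⧸ J) E F k (Ideal.Quotient.factor h)
        (symLatticeAction (O ⧸ I) E F k v (fun τ => (Ideal.Quotient.mk I).comp (φO τ)) g x) =
      symLatticeAction (O ⧸ J) E F k v (fun τ => (Ideal.Quotient.mk J).comp (φO τ)) g
        (latticeChange (O ⧸ I) (O ⧸ J) E F k (Ideal.Quotient.factor h) x) := by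
  rw [latticeChange_symLatticeAction, factor_comp_comp_eq O E F v φO h]

end Factor

end ParallelWeight

end Literature.NumberTheory.Automorphic
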